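/-
Copyright: the b2b-balaban T⁴-continuum CRUX team, row NE7b OWNER lineage `t4-ne7b-p1` (gen 127). Project licence.
-/
import Summits.QuantumFields.BalabanUV.T4Continuum.Spine.NE7b.SupFibreFiniteRangeRemainder
import Literature.Barriers.CriticalPhenomena.RigorousRGSmallParameterGaussianIntegration

/-!
# THE FLUCTUATION LAW SPLITS INTO SCALES: in chart coordinates the Gaussian fluctuation law of (271) IS the tree's `gaussProb M_z` = Mathlib's
# `multivariateGaussian 0 M_z⁻¹` (read on `EuclideanSpace ℝ σ`), and by (273)∕(278) `M_z⁻¹ = c·Σ_{N<J} C_N + M_z⁻¹R_J` with every summand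
# positive semidefinite; so `N(0, M_z⁻¹) = N(0, c·Σ_{N<J}C_N) ∗ N(0, M_z⁻¹R_J)` and `N(0, c·Σ_{N≤J}C_N) = N(0, c·Σ_{N<J}C_N) ∗ N(0, c·C_J)` —
# the fluctuation field is the SUM OF `J + 1` INDEPENDENT centred Gaussian chart fields, the first `J` with covariances `c·C_N` of finite
# chart range `2(2^N − 1)(2r + R_H)` (each a finite-range-dependent reference for the tree's polymer gas by (276)), the last the last-scale
# field: the Brydges–Slade form of the road's fluctuation integral, BY NAME (row NE7b, node U5c; (271)∕(273)∕(278) + the tree's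
# `gaussProb_eq_map_multivariateGaussian` and `multivariateGaussian_conv_multivariateGaussian`; [folklore])

Cell `pub-balaban`, sub-cell `t4`, spine estimate NE7b (`T4WeightBudget.RelWeightBound`; the cell's OWN estimate — NOT PRINTED in
[Bałaban 1983–89], NOT PROVED).  Crux-route work under `Spine/NE7b/` by the row OWNER (`t4-ne7b-p1` gen 127, file (280)) under FREEZE
(0)'s crux-prover clause, on § [NE7bP1-G126-HANDOFF] NEXT (3)(d), at TEA's level; NOTHING of Bałaban's is named as a Lean object, valued or
asserted; no `T4Continuum/Support` leaf typed; no `def`, no notation; zero `sorry`.  Imports (BY NAME): the OWNER's (278)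
`…SupFibreFiniteRangeRemainder` (`inv_mul_frdRemainder_posSemidef`; through it (273) `scaled_isHermitian`, `inverse_frd`,
`chart_hasFiniteRange`, (271) `chart_posDef`, `formIntegral_eq_gaussNorm`, `gaussWeight_chart`); the tree's `Literature/Barriers/CriticalPhenomena/
RigorousRGSmallParameterGaussianIntegration` (`LongRangePhi4.multivariateGaussian_conv_multivariateGaussian` — convolution of centred
Gaussians adds covariances, via characteristic functions, 0 sorry), `B2Eq228Conditioning.gaussProb_eq_map_multivariateGaussian`,
`Literature/Analysis/Matrix/FiniteRangeDecomposition` (`frdPiece`, `frdRemainder`, `posSemidef_frdPiece`, `posSemidef_sum_frdPiece`,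
`hasFiniteRange_frdPiece`).

WHY (located).  (276) turns a finite-range covariance into the finite-range-dependence hypothesis of the tree's polymer gas, but for ONE
Gaussian field; the road's fluctuation field has the full covariance.  The multiscale route integrates the field scale by scale, which is
legitimate exactly when the law is the convolution of the scale laws — for centred Gaussians, when the covariances add and each summand is
positive semidefinite ((273) + (278)).  This file writes that convolution structure for the road's law in chart coordinates, where the law is
Mathlib's `multivariateGaussian` by the tree's dictionary, so that a successor's scale-by-scale expansion is a Fubini over `J + 1` independent
Gaussian integrals, each of the first `J` against a finite-range-dependent reference.

WHAT IS PROVED ([folklore]; (273)'s data: `H` symmetric with floor∕ceiling, chart bound∕ceiling, `M_z(j,k) = H(Pe_j)(Pe_k)`, `c = 4∕(Λ_Hq)`):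
* §1 `fluctuation_law_eq_gaussProb` ((271)'s density, normalised, integrates like `gaussProb M_z`), **`fluctuation_law_chart`** (`gaussProb M_z` is
  `multivariateGaussian 0 M_z⁻¹` read on `σ → ℝ` — the tree's dictionary at the road's `M_z`).
* §2 **`fluctuation_law_split`** (`N(0, M_z⁻¹) = N(0, c·Σ_{N<J}C_N(cM_z)) ∗ N(0, M_z⁻¹R_J(cM_z))`, every `J`), **`scale_peel`**
  (`N(0, c·Σ_{N<J+1}C_N) = N(0, c·Σ_{N<J}C_N) ∗ N(0, c·C_J)`), `scale_posSemidef`, `scale_hasFiniteRange` (each `c·C_N` is positive semidefinite of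
  chart range `2(2^N − 1)(r + R_H + r)` — (276)'s hypotheses for the scale field).
* §3 toy.

HONEST (what this is NOT).  Assembly by name; the Fubini∕independence bookkeeping of an actual scale-by-scale expansion, the size of the
scale covariances, and the smallness of the road's cell factors are the successor's; chart coordinates throughout (the field-carrier reading
is (273)'s pushforward); scalar skeleton ((A3), NC-NE7b-α UNRULED); nothing of Bałaban's asserted.  BY-NAME EFFECT ON THE WALL: NONE.  NE7b NOT
PRINTED ∕ NOT PROVED; spine PROVED 0∕9; rung (B)+1 — the programme's measures remain FINITE-torus statements; NOT the mass gap, NOT Clay.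
HONEST DEPENDENCY: continuum YM on T⁴ ⇐ BetaPertH ∧ nine spine estimates (0∕9 proved); BetaPertH ⇐ (D1) ∧ (D4) ∧ CAP+tail; G-an2-4 gates
asym, D1 and NE2∕3∕4.
-/

set_option autoImplicit false

noncomputable section

namespace Summit.QuantumFields.BalabanUV.T4Continuum.NE7b.SupFibreGaussianScaleSplit

open MeasureTheory ProbabilityTheory Matrix Real
open Literature.MathematicalPhysics.QuantumFieldTheory.Balaban1983to89
open B13GaugeDevices (gaussWeight gaussNorm)
open B2Eq228Conditioning (gaussProb integral_gaussProb_eq gaussProb_eq_map_multivariateGaussian)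
open Literature.Analysis.Matrix (HasFiniteRange frdPiece frdRemainder posSemidef_frdPiece posSemidef_sum_frdPiece hasFiniteRange_frdPiece)
open Literature.Barriers.CriticalPhenomena.LongRangePhi4 (multivariateGaussian_conv_multivariateGaussian)
open SupFibreGaussianCovariance (chart_posDef gaussWeight_chart formIntegral_eq_gaussNorm)
open SupFibreFiniteRangeDecomposition (scaled_isHermitian inverse_frd chart_hasFiniteRange chart_dist_triangle chart_dist_self)
open SupFibreFiniteRangeRemainder (inv_mul_frdRemainder_posSemidef)

variable {ι : Type*} [Fintype ι] {σ : Type} [Fintype σ] [DecidableEq σ]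
  {H : (ι → ℝ) →L[ℝ] (ι → ℝ) →L[ℝ] ℝ} {m p ΛH q : ℝ} (P : (σ → ℝ) →L[ℝ] (ι → ℝ))
  {dι : ι → ι → ℕ} {home : σ → ι} {r RH : ℕ}

/-! ## §1. The fluctuation law in chart coordinates is Mathlib's centred Gaussian with covariance `M_z⁻¹` -/

omit [Fintype ι] in
/-- **THE NORMALISED FIBRE DENSITY INTEGRATES LIKE `gaussProb M_z`**: for every observable `F` of the chart field,
`(∫ e^{−½H(Pz)(Pz)}dz)⁻¹·∫ F(z)e^{−½H(Pz)(Pz)}dz = ∫ F d(gaussProb M_z)`. [folklore] -/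
theorem fluctuation_law_eq_gaussProb (Mz : Matrix σ σ ℝ) (hMz : ∀ j k, Mz j k = H (P (Pi.single j 1)) (P (Pi.single k 1)))
    (F : (σ → ℝ) → ℝ) :
    (∫ z : σ → ℝ, exp (-((1 / 2 : ℝ) * H (P z) (P z))))⁻¹ * ∫ z : σ → ℝ, F z * exp (-((1 / 2 : ℝ) * H (P z) (P z)))
      = ∫ z, F z ∂(gaussProb Mz) := by
  rw [integral_gaussProb_eq, formIntegral_eq_gaussNorm P Mz hMz]
  congr 1
  exact integral_congr_ae (Filter.Eventually.of_forall fun z => by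
    show F z * exp (-((1 / 2 : ℝ) * H (P z) (P z))) = gaussWeight Mz z * F z
    rw [gaussWeight_chart P Mz hMz, mul_comm])

/-- **THE FLUCTUATION LAW IS `N(0, M_z⁻¹)`**: `H` symmetric with floor, chart bound ⟹ `gaussProb M_z` is Mathlib's
`multivariateGaussian 0 M_z⁻¹` on `EuclideanSpace ℝ σ` read on `σ → ℝ` (the tree's dictionary at the road's positive definite `M_z`). [folklore] -/
theorem fluctuation_law_chart (hHsym : ∀ h k : ι → ℝ, H h k = H k h) (hfl : ∀ h : ι → ℝ, m * ∑ x, h x ^ 2 ≤ H h h) (hm : 0 < m)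
    (hP : ∀ z : σ → ℝ, p * ∑ i, z i ^ 2 ≤ ∑ x, P z x ^ 2) (hp : 0 < p) (Mz : Matrix σ σ ℝ)
    (hMz : ∀ j k, Mz j k = H (P (Pi.single j 1)) (P (Pi.single k 1))) :
    gaussProb Mz = (multivariateGaussian 0 Mz⁻¹).map ⇑(MeasurableEquiv.toLp 2 (σ → ℝ)).symm :=
  gaussProb_eq_map_multivariateGaussian (chart_posDef P hHsym hfl hm hP hp Mz hMz)

/-! ## §2. The split into scales -/

omit [Fintype ι] in
/-- **EACH SCALE COVARIANCE `c·C_N(cM_z)` IS POSITIVE SEMIDEFINITE** (`c ≥ 0`, `H` symmetric). [folklore] -/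
theorem scale_posSemidef (hHsym : ∀ h k : ι → ℝ, H h k = H k h) (Mz : Matrix σ σ ℝ)
    (hMz : ∀ j k, Mz j k = H (P (Pi.single j 1)) (P (Pi.single k 1))) {c : ℝ} (hc : 0 ≤ c) (N : ℕ) :
    (c • frdPiece (c • Mz) N).PosSemidef :=
  (posSemidef_frdPiece (scaled_isHermitian P hHsym Mz hMz c) N).smul hc

omit [Fintype ι] [Fintype σ] in
/-- **EACH SCALE COVARIANCE HAS FINITE CHART RANGE `2(2^N − 1)(r + R_H + r)`** (local chart, `H` of range `R_H`). [folklore] -/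
theorem scale_hasFiniteRange [Fintype σ] (htri : ∀ x y w, dι x w ≤ dι x y + dι y w) (hsym : ∀ x y, dι x y = dι y x)
    (hd0 : ∀ x, dι x x = 0) (hHloc : ∀ h k : ι → ℝ, (∀ x y, h x ≠ 0 → k y ≠ 0 → RH < dι x y) → H h k = 0)
    (hPloc : ∀ j x, r < dι (home j) x → P (Pi.single j 1) x = 0) (Mz : Matrix σ σ ℝ)
    (hMz : ∀ j k, Mz j k = H (P (Pi.single j 1)) (P (Pi.single k 1))) (c : ℝ) (N : ℕ) :
    HasFiniteRange (fun j k => dι (home j) (home k)) (2 * (2 ^ N - 1) * (r + RH + r)) (c • frdPiece (c • Mz) N) :=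
  (hasFiniteRange_frdPiece (chart_dist_triangle htri) (chart_dist_self hd0)
    ((chart_hasFiniteRange P htri hsym hHloc hPloc Mz hMz).smul c) N).smul c

omit [Fintype ι] in
/-- **PEELING ONE SCALE**: `N(0, c·Σ_{N<J+1}C_N) = N(0, c·Σ_{N<J}C_N) ∗ N(0, c·C_J)` (`c ≥ 0`, `H` symmetric). [folklore] -/
theorem scale_peel (hHsym : ∀ h k : ι → ℝ, H h k = H k h) (Mz : Matrix σ σ ℝ)
    (hMz : ∀ j k, Mz j k = H (P (Pi.single j 1)) (P (Pi.single k 1))) {c : ℝ} (hc : 0 ≤ c) (J : ℕ) :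
    multivariateGaussian 0 (c • ∑ N ∈ Finset.range (J + 1), frdPiece (c • Mz) N)
      = multivariateGaussian 0 (c • ∑ N ∈ Finset.range J, frdPiece (c • Mz) N) ∗ multivariateGaussian 0 (c • frdPiece (c • Mz) J) := by
  have hAH := scaled_isHermitian P hHsym Mz hMz c
  rw [multivariateGaussian_conv_multivariateGaussian 0 0 ((posSemidef_sum_frdPiece hAH J).smul hc) (scale_posSemidef P hHsym Mz hMz hc J),
    add_zero, Finset.sum_range_succ, smul_add]

/-- **HEADLINE — THE FLUCTUATION LAW SPLITS INTO `J` FINITE-RANGE SCALES AND A LAST SCALE**: under (273)'s hypotheses (`H` symmetric with floor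
`m > 0` and ceiling `Λ_H > 0`, chart bound `p > 0` and ceiling `q > 0`), with `c = 4∕(Λ_Hq)`, for every `J`:
`N(0, M_z⁻¹) = N(0, c·Σ_{N<J}C_N(cM_z)) ∗ N(0, M_z⁻¹R_J(cM_z))` on `EuclideanSpace ℝ σ` — and `gaussProb M_z`, the road's fluctuation law in the
chart, is `N(0, M_z⁻¹)` read on `σ → ℝ` (§1). [folklore] -/
theorem fluctuation_law_split (hHsym : ∀ h k : ι → ℝ, H h k = H k h) (hfl : ∀ h : ι → ℝ, m * ∑ x, h x ^ 2 ≤ H h h) (hm : 0 < m)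
    (hceil : ∀ h : ι → ℝ, H h h ≤ ΛH * ∑ x, h x ^ 2) (hΛH : 0 < ΛH)
    (hP : ∀ z : σ → ℝ, p * ∑ i, z i ^ 2 ≤ ∑ x, P z x ^ 2) (hp : 0 < p)
    (hPceil : ∀ z : σ → ℝ, ∑ x, P z x ^ 2 ≤ q * ∑ i, z i ^ 2) (hq : 0 < q)
    (Mz : Matrix σ σ ℝ) (hMz : ∀ j k, Mz j k = H (P (Pi.single j 1)) (P (Pi.single k 1))) (J : ℕ) :
    multivariateGaussian 0 Mz⁻¹
      = multivariateGaussian 0 ((4 / (ΛH * q)) • ∑ N ∈ Finset.range J, frdPiece ((4 / (ΛH * q)) • Mz) N)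
        ∗ multivariateGaussian 0 (Mz⁻¹ * frdRemainder ((4 / (ΛH * q)) • Mz) J) := by
  have hc : (0 : ℝ) ≤ 4 / (ΛH * q) := by positivity
  have hAH := scaled_isHermitian P hHsym Mz hMz (4 / (ΛH * q))
  rw [multivariateGaussian_conv_multivariateGaussian 0 0 ((posSemidef_sum_frdPiece hAH J).smul hc)
    (inv_mul_frdRemainder_posSemidef P hHsym hfl hm hceil hΛH hP hp hPceil hq Mz hMz J), add_zero,
    ← inverse_frd P hHsym hfl hm hP hp Mz hMz (4 / (ΛH * q)) J]

/-! ## §3. Toy -/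

/-- Toy: peeling with `J = 0` scales — the empty sum of pieces is the zero covariance, and `N(0, c·C_0) = N(0,0) ∗ N(0, c·C_0)` (a Dirac mass at
the origin convolved with the scale-`0` field), here for `Fin 1`, `P = id`, `H h k = h 0·k 0`, `c = 1`. -/
example : ∃ H : (Fin 1 → ℝ) →L[ℝ] (Fin 1 → ℝ) →L[ℝ] ℝ,
    multivariateGaussian 0 ((1 : ℝ) • ∑ N ∈ Finset.range (0 + 1),
        frdPiece ((1 : ℝ) • Matrix.of fun j k : Fin 1 => H (Pi.single j 1) (Pi.single k 1)) N)
      = multivariateGaussian 0 ((1 : ℝ) • ∑ N ∈ Finset.range 0,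
          frdPiece ((1 : ℝ) • Matrix.of fun j k : Fin 1 => H (Pi.single j 1) (Pi.single k 1)) N)
        ∗ multivariateGaussian 0 ((1 : ℝ) • frdPiece ((1 : ℝ) • Matrix.of fun j k : Fin 1 => H (Pi.single j 1) (Pi.single k 1)) 0) := by
  obtain ⟨H, hH⟩ : ∃ H : (Fin 1 → ℝ) →L[ℝ] (Fin 1 → ℝ) →L[ℝ] ℝ, ∀ h k, H h k = h 0 * k 0 :=
    ⟨((ContinuousLinearMap.mul ℝ ℝ).comp (ContinuousLinearMap.proj 0)).flip.comp (ContinuousLinearMap.proj 0) |>.flip,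
      fun h k => by simp⟩
  exact ⟨H, scale_peel (ContinuousLinearMap.id ℝ (Fin 1 → ℝ)) (fun h k => by rw [hH, hH, mul_comm])
    (Matrix.of fun j k : Fin 1 => H (Pi.single j 1) (Pi.single k 1)) (fun _ _ => rfl) zero_le_one 0⟩

end Summit.QuantumFields.BalabanUV.T4Continuum.NE7b.SupFibreGaussianScaleSplit
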